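import Literature.NumberTheory.Automorphic.AutomorphicFormsStableHolds
import Literature.NumberTheory.Automorphic.AutomorphyDatumGLRegular
import Literature.NumberTheory.Automorphic.AutomorphicRepsGLCuspidalL2Step2
import Literature.NumberTheory.Automorphic.AutomorphicRepsGLCuspidalL2Step1ZFinite
import Literature.NumberTheory.Automorphic.CuspFormsBoundedHC
import HarnessLib

/-!
# Harish-Chandra's growth lemma for `GL_n`: discharge of `AutomorphicRepsGL.hasModerateGrowth_lieDeriv`

Topic `NumberTheory/Automorphic`; sibling proof file of `AutomorphicRepsGLCuspidalL2Step2` on its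
named fact `AutomorphicRepsGL.hasModerateGrowth_lieDeriv hcpt` (Borel–Jacquet 1979, 4.3 (ii) for
`GL_n` over a number field: the Lie derivatives `X φ`, `X ∈ 𝔤𝔩_n(K_∞)`, of automorphic forms on
`GL_n(𝔸_K)` have moderate growth; in print via Harish-Chandra's `φ = φ ∗ α`).

The tree proves the growth lemma for every regular automorphy datum over a finite-dimensional
coefficient algebra with `ℝ`-linear involution, by interior elliptic regularity in E. Nelson's `L²`
form (`HasModerateGrowth.lieDeriv_of_isRegular`, `AutomorphicFormsStableHolds`), and the `GL_n` datum
`AutomorphyDatum.gl n K hcpt` is regular (`AutomorphyDatum.isRegular_gl`, `AutomorphyDatumGLRegular`)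
over `K ⊗_ℚ ℝ = ℝ^{r₁} × ℂ^{r₂}` with its standard involution. Hence:

* `HasModerateGrowth.lieDeriv_gl` — `X φ` has moderate growth for `φ` automorphic on `GL_n(𝔸_K)`;
* `AutomorphicRepsGL.hasModerateGrowth_lieDeriv_holds` — **the named fact holds** (no hypothesis
  beyond the standing compactness `hcpt` of `GL_n(𝒪̂_K)` defining the datum);
* the Step-2 reductions of `AutomorphicRepsGLCuspidalL2Step2` with that hypothesis discharged:
  `AutomorphicRepsGL.formsOfL2_lie_stable_of_toLp`, `AutomorphicRepsGL.formsOfL2_isStableSubmodule_of_toLp`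
  (from fact 2 `exists_toLp_mem_invQuot_eq_lieDeriv` alone) and
  `AutomorphicRepsGL.exists_cuspidalRepData_of_L2_of_toLp` (Borel–Jacquet 4.6 for `GL_n` from
  `formsOfL2_ne_bot`, fact 2 and `formsOfL2_irreducible`).

## Step 2 of Borel–Jacquet 4.6 for `GL_n` holds (the Lie algebra part, cuspidal `Π`)

The named fact `AutomorphicRepsGL.formsOfL2_lie_stable hcpt μ` quantifies over CUSPIDAL `Π`
(`CuspidalAutomorphicRepGL`: closed irreducible invariant `Π ≤ L²_cusp`), and for these the `L²` side
of Step 2 needs no convolution identity: a generator `φ = invQuot f` of `V_Π` (`[f] ∈ Π ≤ L²_cusp`,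
`φ` automorphic) is a cusp form (Step 4, `isCuspFormGL_invQuot_of_mem_cuspidalSubspace_holds`),
invariant under `A_G` (`invQuot_mul_left`); hence `X φ` is again an `A_G`-invariant cusp form
(`IsCuspFormGL.lieDeriv_of_hasUniformModerateGrowth` with `hasUniformModerateGrowth_of_center'`,
`CuspFormsBoundedHC`: uniform moderate growth of `A_G`-invariant cusp forms, Borel–Jacquet 4.3 (ii)
and 4.4), so it is bounded (`IsCuspFormGL.bounded_of_center'`, Getz–Hahn 2024, Thm. 9.8.1) and
therefore `X φ = invQuot f_X` with `f_X ∈ ℒ²(μ)` (`exists_toLp_mem_cuspidalSubspace_of_bounded`);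
finally `[f_X]` is the `L²`-derivative at `t = 0` of the orbit `t ↦ R(exp tX) [f]`
(`hasDerivAt_rightRegular_expMem_toLp`, `AutomorphicFormsL2DerivativeIntegral`: the fundamental
theorem of calculus along `exp tX` read in `L²`), an orbit lying in the closed invariant subspace
`Π`, so `[f_X] ∈ Π` — exactly the printed argument of Borel–Jacquet 1979, 4.6 / Getz–Hahn 2024,
Thm. 6.5.2 ("`X φ` represents the derivative of `t ↦ Π(exp tX) [φ]`, `[φ]` being a smooth vector"),
with the differentiability of `[φ]` supplied by the square integrability of `X φ` instead of
Harish-Chandra's `φ = φ ∗ α`: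

* `AutomorphicRepsGL.exists_toLp_mem_invQuot_eq_lieDeriv_of_le_cuspidalSubspace` — the statement of
  fact 2 (`exists_toLp_mem_invQuot_eq_lieDeriv hcpt μ`) for closed invariant `Π ≤ L²_cusp`, PROVED;
* `AutomorphicRepsGL.formsOfL2_lie_stable_holds` — **the named fact `formsOfL2_lie_stable hcpt μ`
  holds** (span induction as in `formsOfL2_lieDeriv_mem_of`);
* `AutomorphicRepsGL.formsOfL2_isStableSubmodule_holds` — **Step 2 of Borel–Jacquet 4.6 for `GL_n`
  holds**: `V_Π` is `(𝔤, K_∞) × GL_n(𝔸_K^∞)`-stable (`formsOfL2_isStableSubmodule_of_lie`);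
* `AutomorphicRepsGL.exists_cuspidalRepData_of_L2_of_irreducible` — Borel–Jacquet 4.6 for `GL_n`
  from F3 (`formsOfL2_irreducible hcpt μ`) ALONE, Steps 1 (`formsOfL2_ne_bot_holds`,
  `AutomorphicRepsGLCuspidalL2Step1ZFinite`), 2 (here) and 4 being theorems.

No definitions, no named facts.

## References

* A. Borel, H. Jacquet, *Automorphic forms and automorphic representations*, Proc. Sympos. Pure
  Math. 33.1 (1979), 4.3 (ii) and 4.6 [BorelJacquetCorvallis1979].
* Harish-Chandra, *Discrete series for semisimple Lie groups II*, Acta Math. 116 (1966), §8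
  [HarishChandra1966]; A. Borel, *Automorphic forms on `SL₂(ℝ)`* (1997), 2.14, 5.6 (c) [Borel1997].
* E. Nelson, *Analytic vectors*, Ann. of Math. 70 (1959), §§6–8 [Nelson1959].
* J. R. Getz, H. Hahn, *An Introduction to Automorphic Representations*, GTM 300 (2024), Thm. 6.5.2
  (p. 121), Thm. 9.8.1 and the proof of Thm. 6.5.1 (p. 192) [GetzHahn2024].
* Harish-Chandra, *Representations of a semisimple Lie group on a Banach space. I*, Trans. AMS 75
  (1953), §7 (p. 209) and §9 (p. 227) [HarishChandraTAMS1953].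
-/

noncomputable section

open scoped MatrixGroups Classical
open NumberField NumberField.mixedEmbedding IsDedekindDomain
open _root_.MeasureTheory

namespace Literature.NumberTheory.Automorphic

variable {n : ℕ} {K : Type} [Field K] [NumberField K] {hcpt : isCompact_glFiniteIntegralLevel n K}

/-! ## The growth lemma and the named fact -/

section Growth

/-- **Harish-Chandra's growth lemma for `GL_n`**: for an automorphic form `φ` on `GL_n(𝔸_K)` and
`X ∈ 𝔤𝔩_n(K_∞)` the Lie derivative `X φ` has moderate growth (with the exponent of `φ`), by
`HasModerateGrowth.lieDeriv_of_isRegular` at the regular `GL_n` datum. Borel–Jacquet 1979, 4.3 (ii);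
Harish-Chandra 1966, §8; Borel 1997, 2.14 and 5.6 (c). [cite: BorelJacquetCorvallis1979, 4.3 (ii)] -/
theorem HasModerateGrowth.lieDeriv_gl {φ : (AdelicGroupData.gl n K).Adelic → ℂ}
    (hφ : IsAutomorphicForm (AutomorphyDatum.gl n K hcpt) φ)
    (X : (AutomorphyDatum.gl n K hcpt).arch.lie) :
    HasModerateGrowth (AutomorphyDatum.gl n K hcpt)
      (lieDeriv (AutomorphyDatum.gl n K hcpt).ofArch X φ) :=
  HasModerateGrowth.lieDeriv_of_isRegular (AutomorphyDatum.isRegular_gl hcpt) hφ X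

variable (hcpt) in
/-- **Discharge of the named fact `AutomorphicRepsGL.hasModerateGrowth_lieDeriv hcpt`**: Lie
derivatives of automorphic forms on `GL_n(𝔸_K)` have moderate growth (Borel–Jacquet 1979, 4.3 (ii);
in print via Harish-Chandra's `φ = φ ∗ α`, here by interior elliptic regularity,
`HasModerateGrowth.lieDeriv_gl`). [cite: BorelJacquetCorvallis1979, 4.3 (ii)] -/
theorem AutomorphicRepsGL.hasModerateGrowth_lieDeriv_holds :
    AutomorphicRepsGL.hasModerateGrowth_lieDeriv hcpt :=
  fun _ hφ X => HasModerateGrowth.lieDeriv_gl hφ X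

end Growth

/-! ## The Step-2 reductions with fact 1 discharged -/

section Step2

variable {μ : Measure (AdelicGroupData.gl n K).automorphicQuotient}
  [(AdelicGroupData.gl n K).IsAutomorphicMeasure μ]

/-- The Lie algebra part of Step 2 from fact 2 alone (fact 1, `hasModerateGrowth_lieDeriv hcpt`, is
now a theorem): `exists_toLp_mem_invQuot_eq_lieDeriv hcpt μ → formsOfL2_lie_stable hcpt μ`.
Borel–Jacquet 1979, 4.3 (ii) and 4.6. [cite: BorelJacquetCorvallis1979, 4.6] -/
theorem AutomorphicRepsGL.formsOfL2_lie_stable_of_toLp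
    (h₂ : AutomorphicRepsGL.exists_toLp_mem_invQuot_eq_lieDeriv hcpt μ) :
    AutomorphicRepsGL.formsOfL2_lie_stable hcpt μ :=
  AutomorphicRepsGL.formsOfL2_lie_stable_of (AutomorphicRepsGL.hasModerateGrowth_lieDeriv_holds hcpt) h₂

/-- Step 2 assembled from fact 2 alone:
`exists_toLp_mem_invQuot_eq_lieDeriv hcpt μ → formsOfL2_isStableSubmodule hcpt μ`.
Borel–Jacquet 1979, 4.3 (ii) and 4.6. [cite: BorelJacquetCorvallis1979, 4.6] -/
theorem AutomorphicRepsGL.formsOfL2_isStableSubmodule_of_toLp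
    (h₂ : AutomorphicRepsGL.exists_toLp_mem_invQuot_eq_lieDeriv hcpt μ) :
    AutomorphicRepsGL.formsOfL2_isStableSubmodule hcpt μ :=
  AutomorphicRepsGL.formsOfL2_isStableSubmodule_of
    (AutomorphicRepsGL.hasModerateGrowth_lieDeriv_holds hcpt) h₂

/-- **Borel–Jacquet 4.6 for `GL_n` from `formsOfL2_ne_bot`, fact 2 and irreducibility**
(`exists_cuspidalRepData_of_L2_of_HC'` with its hypothesis `hasModerateGrowth_lieDeriv hcpt`
discharged). [cite: BorelJacquetCorvallis1979, 4.6] -/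
theorem AutomorphicRepsGL.exists_cuspidalRepData_of_L2_of_toLp
    (h₁ : AutomorphicRepsGL.formsOfL2_ne_bot hcpt μ)
    (h₂ : AutomorphicRepsGL.exists_toLp_mem_invQuot_eq_lieDeriv hcpt μ)
    (h₃ : AutomorphicRepsGL.formsOfL2_irreducible hcpt μ) :
    AutomorphicRepsGL.exists_cuspidalRepData_of_L2 hcpt μ :=
  AutomorphicRepsGL.exists_cuspidalRepData_of_L2_of_HC' h₁
    (AutomorphicRepsGL.hasModerateGrowth_lieDeriv_holds hcpt) h₂ h₃

end Step2

/-! ## Step 2 of Borel–Jacquet 4.6 for `GL_n` holds: the Lie algebra part for cuspidal `Π` -/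

section LieStable

open Filter
open scoped Topology

variable {μ : Measure (AdelicGroupData.gl n K).automorphicQuotient}
  [(AdelicGroupData.gl n K).IsAutomorphicMeasure μ]

/-- **The `L²` side of Step 2 for closed invariant `Π ≤ L²_cusp`, proved** (the statement of the
named fact `AutomorphicRepsGL.exists_toLp_mem_invQuot_eq_lieDeriv hcpt μ` restricted to cuspidal
`Π`). Let `Π ≤ L²_cusp(GL_n(𝔸_K) ⧸ A_G GL_n(K), μ)` be closed and invariant, `f ∈ ℒ²(μ)` with
`[f] ∈ Π` and `φ = invQuot f = (g ↦ f [g⁻¹])` an automorphic form, `X ∈ 𝔤 = 𝔤𝔩_n(K_∞)`. Then there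
is `f_X ∈ ℒ²(μ)` with `[f_X] ∈ Π` and `invQuot f_X = X φ`: `φ` is an `A_G`-invariant cusp form
(Step 4, `isCuspFormGL_invQuot_of_mem_cuspidalSubspace_holds`; `invQuot_mul_left`), so `X φ` is an
`A_G`-invariant cusp form (`IsCuspFormGL.lieDeriv_of_hasUniformModerateGrowth`,
`IsCuspFormGL.hasUniformModerateGrowth_of_center'`), hence bounded (`IsCuspFormGL.bounded_of_center'`)
and of the form `invQuot f_X`, `f_X ∈ ℒ²(μ)` (`exists_toLp_mem_cuspidalSubspace_of_bounded`); and
`[f_X]` is the `L²`-derivative at `0` of `t ↦ R(exp tX) [f] ∈ Π` (`hasDerivAt_rightRegular_expMem_toLp`),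
a limit of difference quotients of vectors of the closed subspace `Π`. Borel–Jacquet 1979, 4.6;
Getz–Hahn 2024, Thm. 6.5.2; Harish-Chandra 1953, §9. [cite: BorelJacquetCorvallis1979, 4.6] -/
theorem AutomorphicRepsGL.exists_toLp_mem_invQuot_eq_lieDeriv_of_le_cuspidalSubspace
    (P : ContRepresentation.ClosedSubrep ((AdelicGroupData.gl n K).rightRegular μ))
    (hP : P ≤ cuspidalSubspace n K μ)
    (f : (AdelicGroupData.gl n K).automorphicQuotient → ℂ) (hf : MemLp f 2 μ) (hfP : hf.toLp f ∈ P)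
    (hφ : IsAutomorphicForm (AutomorphyDatum.gl n K hcpt) (invQuot (AdelicGroupData.gl n K) f))
    (X : (AutomorphyDatum.gl n K hcpt).arch.lie) :
    ∃ (f' : (AdelicGroupData.gl n K).automorphicQuotient → ℂ) (hf' : MemLp f' 2 μ),
      hf'.toLp f' ∈ P ∧
        invQuot (AdelicGroupData.gl n K) f' =
          lieDeriv (AutomorphyDatum.gl n K hcpt).ofArch X (invQuot (AdelicGroupData.gl n K) f) := by
  -- Step 4: `φ = invQuot f` is a cusp form, and it is invariant under `A_G ≤ A_G GL_n(K)`
  have hcusp : IsCuspFormGL n K hcpt (invQuot (AdelicGroupData.gl n K) f) :=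
    AutomorphicRepsGL.isCuspFormGL_invQuot_of_mem_cuspidalSubspace_holds hcpt μ f hf (hP hfP) hφ
  have hA : ∀ z ∈ (AdelicGroupData.gl n K).center', ∀ g,
      invQuot (AdelicGroupData.gl n K) f (z * g) = invQuot (AdelicGroupData.gl n K) f g :=
    fun z hz g => invQuot_mul_left (AdelicGroupData.gl n K) f
      ((AdelicGroupData.gl n K).center'_le_quotientSubgroup hz) g
  -- `X φ` is an `A_G`-invariant cusp form (uniform moderate growth of `A_G`-invariant cusp forms)
  have hXcusp : IsCuspFormGL n K hcpt
      (lieDeriv (AutomorphyDatum.gl n K hcpt).ofArch X (invQuot (AdelicGroupData.gl n K) f)) :=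
    (hcusp.lieDeriv_of_hasUniformModerateGrowth (hcusp.hasUniformModerateGrowth_of_center' hA) X).1
  have hXA : ∀ z ∈ (AdelicGroupData.gl n K).center', ∀ g,
      lieDeriv (AutomorphyDatum.gl n K hcpt).ofArch X (invQuot (AdelicGroupData.gl n K) f) (z * g) =
        lieDeriv (AutomorphyDatum.gl n K hcpt).ofArch X (invQuot (AdelicGroupData.gl n K) f) g := by
    intro z hz g
    simp only [lieDeriv, mul_assoc, hA z hz]
  -- hence bounded, hence `X φ = invQuot f'` with `f' ∈ ℒ²(μ)`
  obtain ⟨f', hf', -, hf'eq, -⟩ :=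
    AutomorphicRepsGL.exists_toLp_mem_cuspidalSubspace_of_bounded (μ := μ) hXcusp.mem_cuspFormsGL hXA
      (hXcusp.bounded_of_center' hXA)
  refine ⟨f', hf', ?_, hf'eq⟩
  -- `[f']` is the `L²`-derivative at `0` of the orbit `t ↦ R(exp tX) [f]`, which stays in the
  -- closed subspace `Π`; so do its difference quotients, and `Π` is closed
  have hD := hasDerivAt_rightRegular_expMem_toLp (AutomorphyDatum.gl n K hcpt) hf hf' hφ.archSmooth X
    hf'eq.symm
  refine P.isClosed.mem_of_tendsto hD.tendsto_slope_zero (Eventually.of_forall fun t => ?_)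
  exact P.toSubmodule.smul_of_tower_mem t⁻¹
    (P.toSubmodule.sub_mem (P.apply_mem _ hfP) (P.apply_mem _ hfP))

variable (hcpt μ) in
/-- **The named fact `AutomorphicRepsGL.formsOfL2_lie_stable hcpt μ` holds: `V_Π` is `𝔤`-stable
for every cuspidal `Π`** (Step 2 of Borel–Jacquet 1979, 4.6 for `GL_n`, Lie algebra part). For
`Π ≤ L²_cusp` closed irreducible invariant, `X ∈ 𝔤𝔩_n(K_∞)` and `φ ∈ V_Π = formsOfL2 hcpt μ Π`,
`X φ ∈ V_Π`: on a generator `φ = invQuot f`,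
`exists_toLp_mem_invQuot_eq_lieDeriv_of_le_cuspidalSubspace` writes `X φ = invQuot f_X` with
`[f_X] ∈ Π`, and `X φ` is an automorphic form (`IsAutomorphicForm.lieDeriv_of` with the proved
growth lemma `hasModerateGrowth_lieDeriv_holds`), so `X φ` is again a generator; the span follows by
additivity (`IsArchSmooth.lieDeriv_add`, elements of `V_Π ≤ 𝒜` being smooth) and homogeneity
(`lieDeriv_smul`) of `X`, as in `formsOfL2_lieDeriv_mem_of`. Borel–Jacquet 1979, 4.3 (ii) and 4.6;
Getz–Hahn 2024, Thm. 6.5.2. [cite: BorelJacquetCorvallis1979, 4.6] -/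
theorem AutomorphicRepsGL.formsOfL2_lie_stable_holds :
    AutomorphicRepsGL.formsOfL2_lie_stable hcpt μ := by
  intro P X φ hφ
  have hsmooth : ∀ ψ ∈ formsOfL2 hcpt μ P.1, IsArchSmooth (AutomorphyDatum.gl n K hcpt).ofArch ψ :=
    fun ψ hψ ↦ automorphicForms_le_archSmooth _ (formsOfL2_le_automorphicForms P.1 hψ)
  induction hφ using Submodule.span_induction with
  | mem φ hgen =>
    obtain ⟨f, hf, hfP, rfl, hφ⟩ := hgen
    obtain ⟨f', hf', hf'P, hf'eq⟩ :=
      AutomorphicRepsGL.exists_toLp_mem_invQuot_eq_lieDeriv_of_le_cuspidalSubspace P.1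
        P.le_cuspidalSubspace f hf hfP hφ X
    rw [← hf'eq]
    exact invQuot_mem_formsOfL2 hf' hf'P
      (hf'eq ▸ hφ.lieDeriv_of (AutomorphicRepsGL.hasModerateGrowth_lieDeriv_holds hcpt) X)
  | zero => rw [lieDeriv_zero_right]; exact zero_mem _
  | add ψ₁ ψ₂ hψ₁ hψ₂ ih₁ ih₂ =>
    rw [IsArchSmooth.lieDeriv_add _ X (hsmooth ψ₁ hψ₁) (hsmooth ψ₂ hψ₂)]
    exact add_mem ih₁ ih₂
  | smul c ψ _ ih => rw [lieDeriv_smul]; exact Submodule.smul_mem _ c ih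

variable (hcpt μ) in
/-- **Step 2 of Borel–Jacquet 1979, 4.6 for `GL_n` holds** (discharge of the named fact
`AutomorphicRepsGL.formsOfL2_isStableSubmodule hcpt μ` of `AutomorphicRepsGLCuspidalL2`): for every
irreducible closed invariant `Π ≤ L²_cusp(GL_n(𝔸_K) ⧸ A_G GL_n(K), μ)` the space `V_Π` of automorphic
forms `g ↦ f [g⁻¹]`, `[f] ∈ Π`, is a `(𝔤, K_∞) × GL_n(𝔸_K^∞)`-stable subspace of `𝒜`
(`formsOfL2_isStableSubmodule_of_lie`: the group part is `formsOfL2_finite_stable`,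
`formsOfL2_k_stable`; the Lie part is `formsOfL2_lie_stable_holds`). Borel–Jacquet 1979, 4.3 and 4.6.
[cite: BorelJacquetCorvallis1979, 4.6] -/
theorem AutomorphicRepsGL.formsOfL2_isStableSubmodule_holds :
    AutomorphicRepsGL.formsOfL2_isStableSubmodule hcpt μ :=
  AutomorphicRepsGL.formsOfL2_isStableSubmodule_of_lie (AutomorphicRepsGL.formsOfL2_lie_stable_holds hcpt μ)

/-- **Borel–Jacquet 1979, 4.6 for `GL_n` from the irreducibility of the Harish-Chandra module
alone**: Steps 1 (`formsOfL2_ne_bot_holds`), 2 (`formsOfL2_lie_stable_holds` with the group part) and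
4 being theorems, F3 `formsOfL2_irreducible hcpt μ` implies `exists_cuspidalRepData_of_L2 hcpt μ` —
every irreducible closed invariant subspace of `L²_cusp` comes from a cuspidal automorphic
representation datum (`exists_cuspidalRepData_of_L2_of_HC`). [cite: BorelJacquetCorvallis1979, 4.6] -/
theorem AutomorphicRepsGL.exists_cuspidalRepData_of_L2_of_irreducible
    (h₃ : AutomorphicRepsGL.formsOfL2_irreducible hcpt μ) :
    AutomorphicRepsGL.exists_cuspidalRepData_of_L2 hcpt μ :=
  AutomorphicRepsGL.exists_cuspidalRepData_of_L2_of_HC (AutomorphicRepsGL.formsOfL2_ne_bot_holds hcpt μ)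
    (AutomorphicRepsGL.formsOfL2_lie_stable_holds hcpt μ) h₃

end LieStable

end Literature.NumberTheory.Automorphic
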